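import Mathlib
import Literature.Analysis.FunctionSpaces.PoissonPointProcess
import Literature.Analysis.FunctionSpaces.PoissonPointProcessUniqueness
import Summits.CriticalPhenomena.CardyFormulaZ2.Theorems.CardyFlipRussoSquareFromVoronoiHubSmallCellsPart1

/-!
# Stub `stub_smallCells` (K0), Part 2 — line `Sketch`, crux `SquareFromVoronoiHub`
# (stmt-CriticalPhenomena-6434): annuli and independence over disjoint blocks of counts

Support file for the K0 stub of `Cruxes/SquareFromVoronoiHub/Lines/Sketch.lean`.

* `shell x w k = {z | k w ≤ |z - x| < (k+1) w}`: the discretisation of the nearest-nucleus distance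
  used by K0 (annuli of width `w` around a lattice site); measurability, disjointness (in `k`, and
  across centres at distance `≥ 2 N w`), covering of discs, and the area bounds
  `|shell k| ≤ π w² (2k+1)`, `Σ_{k<N} |shell k| ≤ π (N w)²`.
* `siteCounts A i c : κ ⊕ κ → ℕ∞` — the vector of counts of the two nucleus configurations
  `c = (c₁, c₂)` in the cells `A i k` attached to the site `i`, and
  `prod_measure_iInter_siteCounts` — **independence over sites**: for two Poisson processes and a
  family of cells `A i k` that is pairwise disjoint over ALL pairs `(i, k)`, events of the form
  `{siteCounts A i c ∈ B i}` for different sites are independent under `P₁ ⊗ P₂`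
  (Kingman 1993, §2.1 axiom (ii), in the form `IsPoissonPointProcess.map_count_pi_eq`: the joint
  law of the counts of a finite disjoint family is the product of its Poisson marginals; the
  grouped law is identified with the product of the site marginals on boxes,
  `Measure.pi_eq_generateFrom`).

References: J. F. C. Kingman, *Poisson Processes* (1993), §2.1; B. Bollobás, O. Riordan,
*Percolation* (2006), Ch. 8 §8.3.
-/

noncomputable section

open scoped Topology MeasureTheory ENNReal
open Filter Set MeasureTheory ProbabilityTheory

namespace Summit.CriticalPhenomena.CardyFormulaZ2.Cruxes.SquareFromVoronoiHub.VoronoiBlocks.SmallCells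

open Literature.Analysis.FunctionSpaces (PointConfig IsPoissonPointProcess)

/-! ### Annuli -/

/-- The `k`-th annulus of width `w` around `x`: `{z | k w ≤ dist z x < (k+1) w}`. [folklore] -/
def shell (x : ℂ) (w : ℝ) (k : ℕ) : Set ℂ :=
  {z | (k : ℝ) * w ≤ dist z x ∧ dist z x < ((k : ℝ) + 1) * w}

/-- Membership in an annulus. [folklore] -/
@[simp] theorem mem_shell {x z : ℂ} {w : ℝ} {k : ℕ} :
    z ∈ shell x w k ↔ (k : ℝ) * w ≤ dist z x ∧ dist z x < ((k : ℝ) + 1) * w := Iff.rfl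

/-- Annuli are measurable. [folklore] -/
theorem measurableSet_shell (x : ℂ) (w : ℝ) (k : ℕ) : MeasurableSet (shell x w k) := by
  have hc : Continuous fun z : ℂ => dist z x := continuous_id.dist continuous_const
  exact (measurableSet_le measurable_const hc.measurable).inter
    (measurableSet_lt hc.measurable measurable_const)

/-- The `k`-th annulus lies in the disc of radius `(k+1) w`. [folklore] -/
theorem shell_subset_ball (x : ℂ) (w : ℝ) (k : ℕ) :
    shell x w k ⊆ Metric.ball x (((k : ℝ) + 1) * w) := fun z hz => by
  rw [Metric.mem_ball]; exact hz.2

/-- Annuli of index `< N` lie in the disc of radius `N w` (`w ≥ 0`). [folklore] -/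
theorem shell_subset_ball_of_lt (x : ℂ) {w : ℝ} (hw : 0 ≤ w) {k N : ℕ} (hk : k < N) :
    shell x w k ⊆ Metric.ball x ((N : ℝ) * w) := fun z hz => by
  rw [Metric.mem_ball]
  have h1 : ((k : ℝ) + 1) * w ≤ (N : ℝ) * w :=
    mul_le_mul_of_nonneg_right (by exact_mod_cast hk) hw
  exact hz.2.trans_le h1

/-- Annuli have finite area. [folklore] -/
theorem volume_shell_ne_top (x : ℂ) (w : ℝ) (k : ℕ) : volume (shell x w k) ≠ ∞ :=
  (measure_ne_top_of_subset (shell_subset_ball x w k) (volume_ball_ne_top x _))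

/-- Distinct annuli around the same centre are disjoint. [folklore] -/
theorem disjoint_shell (x : ℂ) {w : ℝ} (hw : 0 < w) {k l : ℕ} (hkl : k ≠ l) :
    Disjoint (shell x w k) (shell x w l) := by
  rw [Set.disjoint_left]
  rintro z ⟨hk1, hk2⟩ ⟨hl1, hl2⟩
  have h1 : (k : ℝ) < (l : ℝ) + 1 := lt_of_mul_lt_mul_right (hk1.trans_lt hl2) hw.le
  have h2 : (l : ℝ) < (k : ℝ) + 1 := lt_of_mul_lt_mul_right (hl1.trans_lt hk2) hw.le
  have h1' : k < l + 1 := by exact_mod_cast h1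
  have h2' : l < k + 1 := by exact_mod_cast h2
  omega

/-- Annuli of index `< N` around two centres at distance `≥ 2 N w` are disjoint. [folklore] -/
theorem disjoint_shell_of_le_dist {x y : ℂ} {w : ℝ} (hw : 0 ≤ w) {N k l : ℕ} (hk : k < N)
    (hl : l < N) (hxy : 2 * ((N : ℝ) * w) ≤ dist x y) :
    Disjoint (shell x w k) (shell y w l) := by
  rw [Set.disjoint_left]
  intro z hzx hzy
  have h1 := shell_subset_ball_of_lt x hw hk hzx
  have h2 := shell_subset_ball_of_lt y hw hl hzy
  rw [Metric.mem_ball] at h1 h2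
  have := dist_triangle_left x y z
  linarith

/-- A point at distance `< m w` from `x` lies in one of the first `m` annuli (`w > 0`). [folklore] -/
theorem exists_mem_shell {x z : ℂ} {w : ℝ} (hw : 0 < w) {m : ℕ} (h : dist z x < (m : ℝ) * w) :
    ∃ k < m, z ∈ shell x w k := by
  refine ⟨⌊dist z x / w⌋₊, ?_, ?_, ?_⟩
  · exact (Nat.floor_lt (div_nonneg dist_nonneg hw.le)).2 ((div_lt_iff₀ hw).2 h)
  · have := Nat.floor_le (div_nonneg (dist_nonneg (x := z) (y := x)) hw.le)
    calc (⌊dist z x / w⌋₊ : ℝ) * w ≤ (dist z x / w) * w := mul_le_mul_of_nonneg_right this hw.le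
      _ = dist z x := div_mul_cancel₀ _ hw.ne'
  · have := Nat.lt_floor_add_one (dist z x / w)
    calc dist z x = (dist z x / w) * w := (div_mul_cancel₀ _ hw.ne').symm
      _ < ((⌊dist z x / w⌋₊ : ℝ) + 1) * w := mul_lt_mul_of_pos_right this hw

/-- Area bound for one annulus: `|shell x w k| ≤ π w² (2k+1)` (the annulus and the disc of radius
`k w` are disjoint subsets of the disc of radius `(k+1) w`). [folklore] -/
theorem volume_real_shell_le (x : ℂ) {w : ℝ} (hw : 0 ≤ w) (k : ℕ) :
    volume.real (shell x w k) ≤ Real.pi * w ^ 2 * (2 * k + 1) := by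
  have hk0 : (0 : ℝ) ≤ (k : ℝ) * w := mul_nonneg (Nat.cast_nonneg k) hw
  have hdisj : Disjoint (shell x w k) (Metric.ball x ((k : ℝ) * w)) := by
    rw [Set.disjoint_left]
    intro z hz hz'
    rw [Metric.mem_ball] at hz'
    exact absurd hz.1 (not_le.2 hz')
  have hsub : shell x w k ∪ Metric.ball x ((k : ℝ) * w) ⊆ Metric.ball x (((k : ℝ) + 1) * w) := by
    refine Set.union_subset (shell_subset_ball x w k) (Metric.ball_subset_ball ?_)
    nlinarith
  have h1 : volume.real (shell x w k ∪ Metric.ball x ((k : ℝ) * w)) =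
      volume.real (shell x w k) + volume.real (Metric.ball x ((k : ℝ) * w)) :=
    measureReal_union hdisj measurableSet_ball (volume_shell_ne_top x w k) (volume_ball_ne_top x _)
  have h2 : volume.real (shell x w k ∪ Metric.ball x ((k : ℝ) * w)) ≤
      volume.real (Metric.ball x (((k : ℝ) + 1) * w)) :=
    measureReal_mono hsub (volume_ball_ne_top x _)
  rw [h1, volume_real_ball x hk0, volume_real_ball x (by positivity)] at h2
  nlinarith [h2]

/-- Total area bound: `Σ_{k<N} |shell x w k| ≤ π (N w)²`. [folklore] -/
theorem sum_volume_real_shell_le (x : ℂ) {w : ℝ} (hw : 0 < w) (N : ℕ) :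
    ∑ k : Fin N, volume.real (shell x w k) ≤ Real.pi * ((N : ℝ) * w) ^ 2 := by
  have hdisj : Set.PairwiseDisjoint (↑(Finset.univ : Finset (Fin N)) : Set (Fin N))
      (fun k : Fin N => shell x w k) := by
    intro k _ l _ hkl
    exact disjoint_shell x hw (Fin.val_injective.ne hkl)
  have h1 : ∑ k : Fin N, volume.real (shell x w k) = volume.real (⋃ k ∈ (Finset.univ : Finset (Fin N)),
      shell x w k) :=
    (measureReal_biUnion_finset hdisj (fun k _ => measurableSet_shell x w k)
      (fun k _ => volume_shell_ne_top x w k)).symm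
  rw [h1, ← volume_real_ball x (by positivity : (0 : ℝ) ≤ (N : ℝ) * w)]
  refine measureReal_mono ?_ (volume_ball_ne_top x _)
  intro z hz
  simp only [Finset.mem_univ, Set.iUnion_true, Set.mem_iUnion] at hz
  obtain ⟨k, hk⟩ := hz
  exact shell_subset_ball_of_lt x hw.le k.2 hk

/-! ### The Poisson law of one count vector and independence over disjoint blocks -/

section Poisson

variable {E : Type*} [TopologicalSpace E] [MeasurableSpace E]

/-- The Poisson law on `ℕ∞` of mean `m` (the law of one count `N(t)`, `ν t = m`). [folklore] -/
def poi (m : ℝ≥0∞) : Measure ℕ∞ := (poissonMeasure m.toNNReal).map ((↑) : ℕ → ℕ∞)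

/-- `poi m` is a probability measure. [folklore] -/
theorem isProbabilityMeasure_poi (m : ℝ≥0∞) : IsProbabilityMeasure (poi m) :=
  Measure.isProbabilityMeasure_map measurable_from_top.aemeasurable

/-- **Box formula** (Kingman 1993, §2.1 (i)–(ii)): for a finite pairwise disjoint family of
measurable cells of finite intensity, `P {∀ k, N(t k) ∈ T k} = ∏ k Poisson(ν (t k)) (T k)`.
[folklore] -/
theorem measure_forall_count_mem_eq_prod {ν : Measure E} {P : Measure (PointConfig E)}
    (hP : IsPoissonPointProcess ν P) {κ : Type*} [Fintype κ] {t : κ → Set E}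
    (ht : ∀ k, MeasurableSet (t k)) (hd : Pairwise (Function.onFun Disjoint t))
    (hfin : ∀ k, ν (t k) ≠ ∞) (T : κ → Set ℕ∞) :
    P {c | ∀ k, c.count (t k) ∈ T k} = ∏ k, poi (ν (t k)) (T k) := by
  have hm : Measurable fun (c : PointConfig E) k => c.count (t k) :=
    measurable_pi_lambda _ fun k => PointConfig.measurable_count (ht k)
  have hset : {c : PointConfig E | ∀ k, c.count (t k) ∈ T k} =
      (fun c k => c.count (t k)) ⁻¹' Set.pi Set.univ T := by
    ext c; simp
  haveI : ∀ k, IsProbabilityMeasure (poi (ν (t k))) := fun k => isProbabilityMeasure_poi _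
  rw [hset, ← Measure.map_apply hm (MeasurableSet.univ_pi fun k =>
    (Set.to_countable (T k)).measurableSet), hP.map_count_pi_eq ht hd hfin]
  exact Measure.pi_pi _ _

/-- The count vector of the site `i`: counts of the first configuration (left summand) and of the
second configuration (right summand) in the cells `A i k`. [folklore] -/
def siteCounts {ι κ : Type*} (A : ι → κ → Set E) (i : ι) (c : PointConfig E × PointConfig E) :
    κ ⊕ κ → ℕ∞ :=
  Sum.elim (fun k => c.1.count (A i k)) (fun k => c.2.count (A i k))

omit [MeasurableSpace E] in
/-- Left coordinates of `siteCounts` are counts of the first configuration. [folklore] -/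
@[simp] theorem siteCounts_inl {ι κ : Type*} (A : ι → κ → Set E) (i : ι)
    (c : PointConfig E × PointConfig E) (k : κ) : siteCounts A i c (Sum.inl k) = c.1.count (A i k) :=
  rfl

omit [MeasurableSpace E] in
/-- Right coordinates of `siteCounts` are counts of the second configuration. [folklore] -/
@[simp] theorem siteCounts_inr {ι κ : Type*} (A : ι → κ → Set E) (i : ι)
    (c : PointConfig E × PointConfig E) (k : κ) : siteCounts A i c (Sum.inr k) = c.2.count (A i k) :=
  rfl

omit [MeasurableSpace E] in
/-- `siteCounts` of the swapped pair is the swapped vector. [folklore] -/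
theorem siteCounts_swap {ι κ : Type*} (A : ι → κ → Set E) (i : ι)
    (c : PointConfig E × PointConfig E) :
    siteCounts A i c.swap = siteCounts A i c ∘ Sum.swap := by
  funext k'
  rcases k' with k | k <;> rfl

/-- `siteCounts A i` is measurable when the cells are. [folklore] -/
theorem measurable_siteCounts {ι κ : Type*} {A : ι → κ → Set E}
    (hA : ∀ i k, MeasurableSet (A i k)) (i : ι) : Measurable (siteCounts A i) := by
  refine measurable_pi_lambda _ fun k' => ?_
  rcases k' with k | k
  · exact (PointConfig.measurable_count (hA i k)).comp measurable_fst
  · exact (PointConfig.measurable_count (hA i k)).comp measurable_snd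

/-- Events of one site's count vector are measurable. [folklore] -/
theorem measurableSet_siteCounts_preimage {ι κ : Type*} [Fintype κ] {A : ι → κ → Set E}
    (hA : ∀ i k, MeasurableSet (A i k)) (i : ι) (B : Set (κ ⊕ κ → ℕ∞)) :
    MeasurableSet (siteCounts A i ⁻¹' B) :=
  measurable_siteCounts hA i (Set.to_countable B).measurableSet

/-- **Independence over sites** (Kingman 1993, §2.1 axiom (ii)). Let `P₁`, `P₂` be Poisson
processes of intensity `ν` and `A i k` measurable cells of finite intensity, pairwise disjoint
over all pairs `(i, k)`. Then for arbitrary sets `B i` of count vectors,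
`(P₁ ⊗ P₂) (⋂ i, {siteCounts A i ∈ B i}) = ∏ i, (P₁ ⊗ P₂) {siteCounts A i ∈ B i}`.
Proof: the law of the grouped vector `c ↦ (i ↦ siteCounts A i c)` is the product of the site
marginals, by `Measure.pi_eq_generateFrom` on boxes, where both sides are products of Poisson
probabilities (`IsPoissonPointProcess.map_count_pi_eq` and `Measure.prod_prod`). [folklore] -/
theorem prod_measure_iInter_siteCounts {ν : Measure E} {P₁ P₂ : Measure (PointConfig E)}
    (h₁ : IsPoissonPointProcess ν P₁) (h₂ : IsPoissonPointProcess ν P₂)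
    {ι κ : Type*} [Fintype ι] [Fintype κ] {A : ι → κ → Set E}
    (hA : ∀ i k, MeasurableSet (A i k))
    (hd : Pairwise (Function.onFun Disjoint fun j : ι × κ => A j.1 j.2))
    (hfin : ∀ i k, ν (A i k) ≠ ∞) (B : ι → Set (κ ⊕ κ → ℕ∞)) :
    (P₁.prod P₂) (⋂ i, siteCounts A i ⁻¹' B i) = ∏ i, (P₁.prod P₂) (siteCounts A i ⁻¹' B i) := by
  classical
  haveI := h₁.isProbabilityMeasure
  haveI := h₂.isProbabilityMeasure
  -- the cells of one site are pairwise disjoint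
  have hdi : ∀ i, Pairwise (Function.onFun Disjoint (A i)) := fun i k l hkl =>
    hd (show ((i, k) : ι × κ) ≠ (i, l) from fun h => hkl (Prod.ext_iff.1 h).2)
  -- box formulas for one Poisson law
  have hboxAll : ∀ {P : Measure (PointConfig E)}, IsPoissonPointProcess ν P →
      ∀ T : ι × κ → Set ℕ∞, P {c | ∀ j : ι × κ, c.count (A j.1 j.2) ∈ T j} =
        ∏ j : ι × κ, poi (ν (A j.1 j.2)) (T j) := fun hP T =>
    measure_forall_count_mem_eq_prod hP (fun j => hA j.1 j.2) hd (fun j => hfin j.1 j.2) T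
  have hboxOne : ∀ {P : Measure (PointConfig E)}, IsPoissonPointProcess ν P →
      ∀ (i : ι) (T : κ → Set ℕ∞), P {c | ∀ k, c.count (A i k) ∈ T k} =
        ∏ k, poi (ν (A i k)) (T k) := fun hP i T =>
    measure_forall_count_mem_eq_prod hP (fun k => hA i k) (hdi i) (fun k => hfin i k) T
  -- rectangles of the grouped vector factor over the sites
  have hrect : ∀ T : ι → (κ ⊕ κ) → Set ℕ∞,
      (P₁.prod P₂) {c | ∀ i k', siteCounts A i c k' ∈ T i k'} =
        ∏ i, (P₁.prod P₂) {c | ∀ k', siteCounts A i c k' ∈ T i k'} := by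
    intro T
    have hL : {c : PointConfig E × PointConfig E | ∀ i k', siteCounts A i c k' ∈ T i k'} =
        {d : PointConfig E | ∀ j : ι × κ, d.count (A j.1 j.2) ∈ T j.1 (Sum.inl j.2)} ×ˢ
          {e : PointConfig E | ∀ j : ι × κ, e.count (A j.1 j.2) ∈ T j.1 (Sum.inr j.2)} := by
      ext c
      simp only [Set.mem_setOf_eq, Set.mem_prod, Sum.forall, siteCounts_inl, siteCounts_inr,
        Prod.forall]
      exact ⟨fun h => ⟨fun i k => (h i).1 k, fun i k => (h i).2 k⟩,
        fun h i => ⟨fun k => h.1 i k, fun k => h.2 i k⟩⟩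
    have hR : ∀ i, {c : PointConfig E × PointConfig E | ∀ k', siteCounts A i c k' ∈ T i k'} =
        {d : PointConfig E | ∀ k, d.count (A i k) ∈ T i (Sum.inl k)} ×ˢ
          {e : PointConfig E | ∀ k, e.count (A i k) ∈ T i (Sum.inr k)} := by
      intro i
      ext c
      simp only [Set.mem_setOf_eq, Set.mem_prod, Sum.forall, siteCounts_inl, siteCounts_inr]
    rw [hL, Measure.prod_prod, hboxAll h₁, hboxAll h₂]
    simp_rw [hR, Measure.prod_prod, hboxOne h₁, hboxOne h₂]
    rw [Finset.prod_mul_distrib, Fintype.prod_prod_type, Fintype.prod_prod_type]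
  -- the grouped vector and the site marginals
  set Z : PointConfig E × PointConfig E → (ι → (κ ⊕ κ → ℕ∞)) := fun c i => siteCounts A i c
    with hZ
  have hZm : Measurable Z := measurable_pi_lambda _ fun i => measurable_siteCounts hA i
  set ρ : ι → Measure (κ ⊕ κ → ℕ∞) := fun i => (P₁.prod P₂).map (siteCounts A i) with hρ
  haveI : ∀ i, IsProbabilityMeasure (ρ i) := fun i =>
    Measure.isProbabilityMeasure_map (measurable_siteCounts hA i).aemeasurable
  -- the law of the grouped vector is the product of the site marginals
  have hpi : Measure.pi ρ = (P₁.prod P₂).map Z := by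
    refine Measure.pi_eq_generateFrom (fun i => generateFrom_pi) (fun i => isPiSystem_pi)
      (fun i => ?_) ?_
    · exact ⟨fun _ => Set.univ,
        fun _ => ⟨fun _ => Set.univ, fun _ _ => Set.mem_setOf.2 MeasurableSet.univ, Set.pi_univ _⟩,
        fun _ => measure_lt_top _ _, Set.iUnion_const _⟩
    · intro S hS
      choose T hT hTS using hS
      have hSm : ∀ i, MeasurableSet (S i) := fun i =>
        (hTS i) ▸ MeasurableSet.univ_pi fun k' => hT i k' (Set.mem_univ _)
      rw [Measure.map_apply hZm (MeasurableSet.univ_pi hSm)]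
      have e1 : Z ⁻¹' Set.pi Set.univ S = {c | ∀ i k', siteCounts A i c k' ∈ T i k'} := by
        ext c
        simp only [Set.mem_preimage, Set.mem_univ_pi, Set.mem_setOf_eq, hZ]
        refine forall_congr' fun i => ?_
        rw [← hTS i, Set.mem_univ_pi]
      have e2 : ∀ i, ρ i (S i) = (P₁.prod P₂) {c | ∀ k', siteCounts A i c k' ∈ T i k'} := by
        intro i
        rw [hρ, Measure.map_apply (measurable_siteCounts hA i) (hSm i)]
        congr 1
        ext c
        rw [Set.mem_preimage, ← hTS i, Set.mem_univ_pi]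
        rfl
      rw [e1, hrect T]
      exact Finset.prod_congr rfl fun i _ => (e2 i).symm
  -- conclusion
  have hB : ∀ i, MeasurableSet (B i) := fun i => (Set.to_countable (B i)).measurableSet
  have e3 : (⋂ i, siteCounts A i ⁻¹' B i) = Z ⁻¹' Set.pi Set.univ B := by
    ext c; simp [hZ]
  rw [e3, ← Measure.map_apply hZm (MeasurableSet.univ_pi hB), ← hpi, Measure.pi_pi]
  exact Finset.prod_congr rfl fun i _ => Measure.map_apply (measurable_siteCounts hA i) (hB i)

/-- Real-valued form of `prod_measure_iInter_siteCounts`. [folklore] -/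
theorem prod_measureReal_iInter_siteCounts {ν : Measure E} {P₁ P₂ : Measure (PointConfig E)}
    (h₁ : IsPoissonPointProcess ν P₁) (h₂ : IsPoissonPointProcess ν P₂)
    {ι κ : Type*} [Fintype ι] [Fintype κ] {A : ι → κ → Set E}
    (hA : ∀ i k, MeasurableSet (A i k))
    (hd : Pairwise (Function.onFun Disjoint fun j : ι × κ => A j.1 j.2))
    (hfin : ∀ i k, ν (A i k) ≠ ∞) (B : ι → Set (κ ⊕ κ → ℕ∞)) :
    (P₁.prod P₂).real (⋂ i, siteCounts A i ⁻¹' B i) =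
      ∏ i, (P₁.prod P₂).real (siteCounts A i ⁻¹' B i) := by
  simp only [measureReal_def, prod_measure_iInter_siteCounts h₁ h₂ hA hd hfin B,
    ENNReal.toReal_prod]

end Poisson

/-! ### Registered sub-goal of the stub (Part 2) -/

/-- **Part 2 of stub `stub_smallCells`, registered sub-goal** (`--supports stmt-CriticalPhenomena-6434`):
independence over sites `prod_measure_iInter_siteCounts` as a closed statement. [folklore] -/
theorem stub_smallCells_part2 : ∀ {E : Type*} [TopologicalSpace E] [MeasurableSpace E]
    {ν : Measure E} {P₁ P₂ : Measure (PointConfig E)}, IsPoissonPointProcess ν P₁ →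
    IsPoissonPointProcess ν P₂ → ∀ {ι κ : Type*} [Fintype ι] [Fintype κ] {A : ι → κ → Set E},
    (∀ i k, MeasurableSet (A i k)) → Pairwise (Function.onFun Disjoint fun j : ι × κ => A j.1 j.2) →
    (∀ i k, ν (A i k) ≠ ∞) → ∀ B : ι → Set (κ ⊕ κ → ℕ∞),
    (P₁.prod P₂) (⋂ i, siteCounts A i ⁻¹' B i) = ∏ i, (P₁.prod P₂) (siteCounts A i ⁻¹' B i) := by
  intro E _ _ ν P₁ P₂ h₁ h₂ ι κ _ _ A hA hd hfin B
  exact prod_measure_iInter_siteCounts h₁ h₂ hA hd hfin B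

end Summit.CriticalPhenomena.CardyFormulaZ2.Cruxes.SquareFromVoronoiHub.VoronoiBlocks.SmallCells

end
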